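import Summits.CriticalPhenomena.PercolationContinuityZ3.Theorems.PercNearOneGluingNoHeavyLowerTailStarLemmaBlocksFinset
import Summits.CriticalPhenomena.PercolationContinuityZ3.Theorems.PercNearOneGluingNoHeavyLowerTailStarDisintegration
import Summits.CriticalPhenomena.PercolationContinuityZ3.Theorems.PercNearOneGluingNoHeavyLowerTailStarPatternReduce
import Summits.CriticalPhenomena.PercolationContinuityZ3.Theorems.PercNearOneGluingNoHeavyLowerTailStarBadFibre
import Summits.CriticalPhenomena.PercolationContinuityZ3.Theorems.PercNearOneGluingNoHeavyLowerTailStarUnrelFibre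
import Summits.CriticalPhenomena.PercolationContinuityZ3.Theorems.PercNearOneGluingNoHeavyLowerTailStarBlockExchangeLaw
import Literature.Probability.Percolation.SeedLemma
import Mathlib

/-!
# Crux `PercNearOneGluing.NoHeavyLowerTail` (stmt-CriticalPhenomena-4575), line
`bhk-superadditivity-thinning` — stub `firstHitChargingStar` (first-hit charging with true budgets
for star-attached observers)

File of the crux skeleton (lead prover-line-stmt-CriticalPhenomena-4575-c3-0): proves exactly the
registered stub signature `firstHitChargingStar`; lands with
`--supports stmt-CriticalPhenomena-4575`.

## The theorem

Bond percolation with independent edges on the complete graph `Fin n`, law `μ = prodBernoulli w`.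
An observer `o` is attached to a finite set `A ∌ o` of relay points by the pairs `s(o, a)`,
`a ∈ A`, of weights `q a = w s(o, a)` (every other pair at `o` has weight `0`), and `b ∈ A` is the
target.  Write `x ~ y` for "`x ↔ y` by an open path avoiding `o`", `d a = μ(a ≁ b)` for the
*deadness* of a relay point, and say that `a'` *beats* `a` if `d a < d a'`, ties broken by the
index (`d a = d a' ∧ a < a'`).  Then

`μ(o ↔ A, o ↮ b) ≤ Σ_{a ∈ A} q a · (∏_{a' beats a} (1 - q a')) · μ(a ↮ b)`:

the bad event "`o` is joined to `A` but not to `b`" is charged to the relay points, the relay point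
`a` receiving the probability that its pair is open while the pairs of all the relay points beating
it are closed (a first-hit weight for the priority "deader first"), times its TRUE budget
`μ(a ↮ b)` (plain connection, through `o` allowed).

## Proof (assembly)

Disintegrate `μ` into the configuration `η` off `o` and the star pattern at `o`
(`starDisintegration`), collapse the star pattern to the set of opened relay points
(`starPatternReduce`), and compute the two fibre integrals: the bad event has conditional
probability `Π_{L(η)} - Π_A` (`starBadFibre`) and `{a ↮ b}` has conditional probability
`1{a ∉ L(η)} (Π_{cl_a(η)} + Π_{L(η)} - Π_{cl_a(η)} Π_{L(η)})` (`starUnrelFibre`), where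
`L(η) = {a' ∈ A | a' ~ b}` is the alive set and `cl_x(η) = {a' ∈ A | x ~ a'}` the block of `x`.
The resulting law-level inequality is the Block Star Lemma `starLemmaBlocks_finset` (the
law-level induction `starLemmaBlocks` transported to the unit set `A` ranked by deadness), whose
block-exchange hypothesis is Kozma–Nitzan's Lemma 3(ii) exchange `blockExchange` in law form
(`starBlockExchangeLaw`), available because a relay point of smaller rank is at most as dead.

Credits: law-level induction `starLemmaBlocks` + KN Lemma 3(ii) exchange `blockExchange`
(Kozma–Nitzan); the present file only assembles the landed pieces.
-/

open scoped Classical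

namespace Summit.CriticalPhenomena.PercolationContinuityZ3.Theorems

open MeasureTheory
open Literature.Probability.LatticeModels (prodBernoulli)
open Literature.Probability.Percolation

section FirstHitChargingStarAux

variable {n : ℕ}

/-- **A ranking realising a linear key.**  For a key `key : α → β` into a linear order, injective
on the finite set `U`, the rank `a ↦ #{x ∈ U | key x < key a}` is injective on `U` and
`rank a < rank a' ↔ key a < key a'` on `U`. [folklore] -/
theorem starFH_rank {α β : Type*} [LinearOrder β] (U : Finset α) (key : α → β)
    (hkey : Set.InjOn key ↑U) :
    ∃ rank : α → ℕ, Set.InjOn rank ↑U ∧ ∀ a ∈ U, ∀ a' ∈ U, (rank a < rank a' ↔ key a < key a') := by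
  obtain ⟨rank, hrank⟩ : ∃ rank : α → ℕ, ∀ a, rank a = (U.filter (fun x => key x < key a)).card :=
    ⟨_, fun _ => rfl⟩
  have hiff : ∀ a ∈ U, ∀ a' ∈ U, (rank a < rank a' ↔ key a < key a') := by
    intro a ha a' ha'
    rw [hrank, hrank]
    constructor
    · intro h
      by_contra hle
      rw [not_lt] at hle
      refine absurd h (not_lt.2 (Finset.card_le_card (fun x hx => ?_)))
      rw [Finset.mem_filter] at hx ⊢
      exact ⟨hx.1, hx.2.trans_le hle⟩
    · intro h
      refine Finset.card_lt_card ((Finset.ssubset_iff_of_subset (fun x hx => ?_)).2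
        ⟨a, Finset.mem_filter.2 ⟨ha, h⟩, fun hx => lt_irrefl _ (Finset.mem_filter.1 hx).2⟩)
      rw [Finset.mem_filter] at hx ⊢
      exact ⟨hx.1, hx.2.trans h⟩
  refine ⟨rank, fun a ha a' ha' h => ?_, hiff⟩
  have ha₁ : a ∈ U := Finset.mem_coe.1 ha
  have ha₁' : a' ∈ U := Finset.mem_coe.1 ha'
  refine hkey ha ha' (le_antisymm (not_lt.1 (fun hlt => ?_)) (not_lt.1 (fun hlt => ?_)))
  · have := (hiff a' ha₁' a ha₁).2 hlt
    omega
  · have := (hiff a ha₁ a' ha₁').2 hlt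
    omega

/-- **Loops are invisible to the open graph**: inserting the diagonal pair `s(o, o)` into a
configuration does not change its open graph (the open graph has no loops). [folklore] -/
theorem starFH_openGraph_insert_diag (ω : Set (Sym2 (Fin n))) (o : Fin n) :
    openGraph (insert s(o, o) ω : BondConfig (Fin n)) = openGraph (ω : BondConfig (Fin n)) := by
  ext x y
  rw [openGraph_adj, openGraph_adj, Set.mem_insert_iff]
  constructor
  · rintro ⟨h | h, hne⟩
    · rcases Sym2.eq_iff.1 h with ⟨hx, hy⟩ | ⟨hx, hy⟩
      · exact absurd (hx.trans hy.symm) hne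
      · exact absurd (hx.trans hy.symm) hne
    · exact ⟨h, hne⟩
  · rintro ⟨h, hne⟩
    exact ⟨Or.inr h, hne⟩

/-- **Loops are invisible to connections**: `x ↔ y` in `insert s(o, o) ω` iff `x ↔ y` in `ω`.
[folklore] -/
theorem starFH_openConn_insert_diag (ω : Set (Sym2 (Fin n))) (o x y : Fin n) :
    (insert s(o, o) ω : Set (Sym2 (Fin n))) ∈ (openConn x y : Set (BondConfig (Fin n))) ↔
      ω ∈ (openConn x y : Set (BondConfig (Fin n))) := by
  show (openGraph (insert s(o, o) ω : BondConfig (Fin n))).Reachable x y ↔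
    (openGraph (ω : BondConfig (Fin n))).Reachable x y
  rw [starFH_openGraph_insert_diag]

/-- A pattern of pairs off `o` (a subset of `univ \ {e | o ∈ e}`) has no pair containing `o`.
[folklore] -/
theorem starFH_off {o : Fin n} {η : Finset (Sym2 (Fin n))}
    (hη : η ∈ ((Finset.univ : Finset (Sym2 (Fin n))) \
      (Finset.univ : Finset (Sym2 (Fin n))).filter (fun e => o ∈ e)).powerset) :
    ∀ e ∈ η, o ∉ e := by
  intro e he hoe
  have h := Finset.mem_powerset.1 hη he
  rw [Finset.mem_sdiff] at h
  exact h.2 (Finset.mem_filter.2 ⟨Finset.mem_univ _, hoe⟩)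

/-- **Block axioms of the `o`-avoiding connection.**  With `L(η) = {a' ∈ A | a' ~ b}` and
`cl_x(η) = {a' ∈ A | x ~ a'}` (`~` = joined in `η` avoiding `o`, an equivalence relation on
`{o}ᶜ ⊇ A`): every `a ∈ A` lies in its block, the block of a dead point avoids the alive set, and a
point in the block of `a'` has the same block. [folklore] -/
theorem starFH_blocks (A : Finset (Fin n)) (o b : Fin n) (hoA : o ∉ A)
    (L : Finset (Sym2 (Fin n)) → Finset (Fin n))
    (cl : Finset (Sym2 (Fin n)) → Fin n → Finset (Fin n))
    (hL : ∀ η, L η = A.filter (fun a' => (↑η : Set (Sym2 (Fin n))) ∈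
      Literature.Probability.Percolation.openConnIn (({o} : Set (Fin n))ᶜ) a' b))
    (hcl : ∀ η x, cl η x = A.filter (fun a' => (↑η : Set (Sym2 (Fin n))) ∈
      Literature.Probability.Percolation.openConnIn (({o} : Set (Fin n))ᶜ) x a'))
    (s : Finset (Finset (Sym2 (Fin n)))) :
    (∀ η ∈ s, ∀ a ∈ A, a ∈ cl η a) ∧
      (∀ η ∈ s, ∀ a ∈ A, a ∉ L η → Disjoint (cl η a) (L η)) ∧
      (∀ η ∈ s, ∀ a ∈ A, ∀ a' ∈ A, a' ∉ L η → a ∈ cl η a' → cl η a = cl η a') := by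
  have hAo : ∀ a ∈ A, a ∈ (({o} : Set (Fin n))ᶜ) := by
    intro a ha
    rw [Set.mem_compl_iff, Set.mem_singleton_iff]
    rintro rfl
    exact hoA ha
  refine ⟨fun η _ a ha => ?_, fun η _ a ha haL => ?_, fun η _ a _ a' _ _ haa' => ?_⟩
  · rw [hcl, Finset.mem_filter]
    exact ⟨ha, hAo a ha, hAo a ha, SimpleGraph.Reachable.refl _⟩
  · rw [Finset.disjoint_left]
    intro x hxc hxL
    rw [hcl, Finset.mem_filter] at hxc
    rw [hL, Finset.mem_filter] at hxL
    refine haL ?_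
    rw [hL, Finset.mem_filter]
    exact ⟨ha, GM.openConnIn_trans hxc.2 hxL.2⟩
  · rw [hcl, Finset.mem_filter] at haa'
    ext x
    rw [hcl, hcl, Finset.mem_filter, Finset.mem_filter]
    exact and_congr_right (fun _ => ⟨fun h => GM.openConnIn_trans haa'.2 h,
      fun h => GM.openConnIn_trans (GM.openConnIn_comm.1 haa'.2) h⟩)

/-- **Law of the bad event, fibrewise.**  Disintegrating over the configuration `η` off `o`
(`starDisintegration`), collapsing the star pattern to the opened relay set (`starPatternReduce`;
the loop `s(o, o)` is invisible to connections) and integrating the fibre (`starBadFibre`):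
`μ(o ↔ A, o ↮ b) = Σ_η μ[η] (Π_{L(η)} - Π_A)` with `Π_X = ∏_{a ∈ A} (1{a ∈ X}(1 - q a) + 1{a ∉ X})`.
[folklore] -/
theorem starFH_badLaw (w : Sym2 (Fin n) → unitInterval) (A : Finset (Fin n)) (o b : Fin n)
    (hoA : o ∉ A) (hbA : b ∈ A) (hw0 : ∀ v : Fin n, v ∉ A → v ≠ o → w s(o, v) = 0)
    (Ho : Finset (Sym2 (Fin n)))
    (hHo : Ho = (Finset.univ : Finset (Sym2 (Fin n))) \
      (Finset.univ : Finset (Sym2 (Fin n))).filter (fun e => o ∈ e))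
    (p : Finset (Sym2 (Fin n)) → ℝ)
    (hp : ∀ η, p η = (Literature.Probability.LatticeModels.prodBernoulli w).real
      (Literature.Probability.Percolation.localCylinder (↑Ho : Set (Sym2 (Fin n)))
        (↑η : Set (Sym2 (Fin n)))))
    (L : Finset (Sym2 (Fin n)) → Finset (Fin n))
    (hL : ∀ η, L η = A.filter (fun a' => (↑η : Set (Sym2 (Fin n))) ∈
      Literature.Probability.Percolation.openConnIn (({o} : Set (Fin n))ᶜ) a' b)) :
    (Literature.Probability.LatticeModels.prodBernoulli w).real
        ((⋃ a ∈ A, Literature.Probability.Percolation.openConn o a) ∩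
          (Literature.Probability.Percolation.openConn o b)ᶜ) =
      ∑ η ∈ Ho.powerset, p η *
        ((∏ a ∈ A, (if a ∈ L η then (1 : ℝ) - ((w s(o, a) : unitInterval) : ℝ) else 1)) -
          ∏ a ∈ A, ((1 : ℝ) - ((w s(o, a) : unitInterval) : ℝ))) := by
  subst hHo
  rw [starDisintegration n w o]
  refine Finset.sum_congr rfl (fun η hη => ?_)
  rw [hp]
  congr 1
  refine (starPatternReduce n w A o _ hoA hw0 (fun ξ => ?_)).trans ?_
  · simp only [Finset.coe_insert, Set.insert_union, Set.mem_inter_iff, Set.mem_iUnion,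
      Set.mem_compl_iff, starFH_openConn_insert_diag]
  · rw [hL, ← starBadFibre n w A o b η hoA hbA (starFH_off hη)]
    refine Finset.sum_congr rfl (fun S _ => ?_)
    congr 2

/-- **Law of the true budget of a relay point, fibrewise.**  As in `starFH_badLaw`, with the
fibre integral `starUnrelFibre`: for `a₀ ∈ A`,
`μ(a₀ ↮ b) = Σ_η μ[η] 1{a₀ ∉ L(η)} (Π_{cl_{a₀}(η)} + Π_{L(η)} - Π_{cl_{a₀}(η)} Π_{L(η)})`.
[folklore] -/
theorem starFH_unrelLaw (w : Sym2 (Fin n) → unitInterval) (A : Finset (Fin n)) (o b a₀ : Fin n)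
    (hoA : o ∉ A) (hbA : b ∈ A) (ha₀A : a₀ ∈ A)
    (hw0 : ∀ v : Fin n, v ∉ A → v ≠ o → w s(o, v) = 0)
    (Ho : Finset (Sym2 (Fin n)))
    (hHo : Ho = (Finset.univ : Finset (Sym2 (Fin n))) \
      (Finset.univ : Finset (Sym2 (Fin n))).filter (fun e => o ∈ e))
    (p : Finset (Sym2 (Fin n)) → ℝ)
    (hp : ∀ η, p η = (Literature.Probability.LatticeModels.prodBernoulli w).real
      (Literature.Probability.Percolation.localCylinder (↑Ho : Set (Sym2 (Fin n)))
        (↑η : Set (Sym2 (Fin n)))))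
    (L : Finset (Sym2 (Fin n)) → Finset (Fin n))
    (hL : ∀ η, L η = A.filter (fun a' => (↑η : Set (Sym2 (Fin n))) ∈
      Literature.Probability.Percolation.openConnIn (({o} : Set (Fin n))ᶜ) a' b))
    (cl : Finset (Sym2 (Fin n)) → Fin n → Finset (Fin n))
    (hcl : ∀ η x, cl η x = A.filter (fun a' => (↑η : Set (Sym2 (Fin n))) ∈
      Literature.Probability.Percolation.openConnIn (({o} : Set (Fin n))ᶜ) x a')) :
    (Literature.Probability.LatticeModels.prodBernoulli w).real
        (Literature.Probability.Percolation.openConn a₀ b)ᶜ =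
      ∑ η ∈ Ho.powerset, p η * (if a₀ ∈ L η then (0 : ℝ) else
        ((∏ a' ∈ A, (if a' ∈ cl η a₀ then (1 : ℝ) - ((w s(o, a') : unitInterval) : ℝ) else 1)) +
          (∏ a' ∈ A, (if a' ∈ L η then (1 : ℝ) - ((w s(o, a') : unitInterval) : ℝ) else 1)) -
          (∏ a' ∈ A, (if a' ∈ cl η a₀ then (1 : ℝ) - ((w s(o, a') : unitInterval) : ℝ) else 1)) *
            (∏ a' ∈ A,
              (if a' ∈ L η then (1 : ℝ) - ((w s(o, a') : unitInterval) : ℝ) else 1)))) := by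
  subst hHo
  rw [starDisintegration n w o]
  refine Finset.sum_congr rfl (fun η hη => ?_)
  rw [hp]
  congr 1
  refine (starPatternReduce n w A o _ hoA hw0 (fun ξ => ?_)).trans ?_
  · simp only [Finset.coe_insert, Set.insert_union, Set.mem_compl_iff,
      starFH_openConn_insert_diag]
  · rw [hL, hcl, ← starUnrelFibre n w A o b a₀ η hoA hbA ha₀A (starFH_off hη)]
    refine Finset.sum_congr rfl (fun S _ => ?_)
    congr 2

/-- **The block-exchange hypothesis for the percolation law.**  For the rank by deadness
(`rank z < rank m → μ(z ≁ b) ≤ μ(m ≁ b)`), the block-exchange hypothesis of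
`starLemmaBlocks_finset` holds: for `Z = ∅` its left side vanishes, and otherwise it is
`starBlockExchangeLaw` (Kozma–Nitzan Lemma 3(ii) in law form) at any `z ∈ Z`. -/
theorem starFH_blockExchange (w : Sym2 (Fin n) → unitInterval) (A : Finset (Fin n)) (o b : Fin n)
    (hoA : o ∉ A) (hbA : b ∈ A)
    (Ho : Finset (Sym2 (Fin n)))
    (hHo : Ho = (Finset.univ : Finset (Sym2 (Fin n))) \
      (Finset.univ : Finset (Sym2 (Fin n))).filter (fun e => o ∈ e))
    (p : Finset (Sym2 (Fin n)) → ℝ)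
    (hp : ∀ η, p η = (Literature.Probability.LatticeModels.prodBernoulli w).real
      (Literature.Probability.Percolation.localCylinder (↑Ho : Set (Sym2 (Fin n)))
        (↑η : Set (Sym2 (Fin n)))))
    (L : Finset (Sym2 (Fin n)) → Finset (Fin n))
    (hL : ∀ η, L η = A.filter (fun a' => (↑η : Set (Sym2 (Fin n))) ∈
      Literature.Probability.Percolation.openConnIn (({o} : Set (Fin n))ᶜ) a' b))
    (cl : Finset (Sym2 (Fin n)) → Fin n → Finset (Fin n))
    (hcl : ∀ η x, cl η x = A.filter (fun a' => (↑η : Set (Sym2 (Fin n))) ∈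
      Literature.Probability.Percolation.openConnIn (({o} : Set (Fin n))ᶜ) x a'))
    (rank : Fin n → ℕ)
    (hrank : ∀ z ∈ A, ∀ m ∈ A, rank z < rank m →
      (Literature.Probability.LatticeModels.prodBernoulli w).real
          (Literature.Probability.Percolation.openConnIn (({o} : Set (Fin n))ᶜ) z b)ᶜ ≤
        (Literature.Probability.LatticeModels.prodBernoulli w).real
          (Literature.Probability.Percolation.openConnIn (({o} : Set (Fin n))ᶜ) m b)ᶜ) :
    ∀ m ∈ A, ∀ Z : Finset (Fin n), Z ⊆ A.filter (fun a => rank a < rank m) → ∀ h ∈ A,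
      rank h < rank m →
      (∑ η ∈ Ho.powerset, p η * (if m ∈ L η ∧ h ∉ L η ∧ Disjoint Z (L η) ∧ ¬ Disjoint Z (cl η h)
        then (1 : ℝ) else 0)) ≤
        ∑ η ∈ Ho.powerset, p η * (if m ∉ L η ∧ Disjoint Z (cl η m) ∧ ¬ Disjoint Z (L η) ∧
          h ∉ cl η m then (1 : ℝ) else 0) := by
  intro m hm Z hZ h hh _
  rcases Z.eq_empty_or_nonempty with rfl | ⟨z, hz⟩
  · refine (Finset.sum_eq_zero (fun η _ => ?_)).trans_le (Finset.sum_nonneg (fun η _ => ?_))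
    · rw [if_neg (fun hc => hc.2.2.2 (Finset.disjoint_empty_left _)), mul_zero]
    · refine mul_nonneg (by rw [hp]; exact measureReal_nonneg) ?_
      split_ifs <;> norm_num
  · have hzA : z ∈ A ∧ rank z < rank m := Finset.mem_filter.1 (hZ hz)
    have hZA : Z ⊆ A := fun x hx => (Finset.mem_filter.1 (hZ hx)).1
    have key := starBlockExchangeLaw n w A o b m h z Z hoA hbA hm hh hZA hz
      (hrank z hzA.1 m hm hzA.2)
    subst hHo
    simpa only [hp, hL, hcl] using key

end FirstHitChargingStarAux

/-- **First-hit charging with true budgets for a star-attached observer** (registered stub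
`firstHitChargingStar` of crux stmt-CriticalPhenomena-4575, line bhk-superadditivity-thinning).
Bond percolation `μ = prodBernoulli w` on the complete graph `Fin n`; an observer `o ∉ A` whose
only pairs of positive weight lead to the relay set `A`, with `q a = w s(o, a)`; a target `b ∈ A`;
deadness `d a = μ(a ↮ b avoiding o)`, and `a'` beats `a` iff `d a < d a'`, or `d a = d a'` and
`a < a'`.  Then
`μ({o ↔ A} ∩ {o ↮ b}) ≤ Σ_{a ∈ A} q a (∏_{a' ∈ A, a' beats a} (1 - q a')) μ(a ↮ b)`.
Proof: the law-level Block Star Lemma `starLemmaBlocks_finset` (induction `starLemmaBlocks`)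
for the law of the configuration off `o` (`starDisintegration`, `starPatternReduce`), whose bad
side and budget side are identified by the fibre identities `starBadFibre`, `starUnrelFibre`
(`starFH_badLaw`, `starFH_unrelLaw`), the units `A` being ranked by deadness, and whose
block-exchange hypothesis is Kozma–Nitzan's Lemma 3(ii) exchange `blockExchange` in law form
(`starBlockExchangeLaw`, `starFH_blockExchange`). -/
theorem firstHitChargingStar : ∀ (n : ℕ) (w : Sym2 (Fin n) → unitInterval) (A : Finset (Fin n)) (o b : Fin n), b ∈ A → o ∉ A → (∀ v : Fin n, v ∉ A → v ≠ o → w s(o, v) = 0) → (Literature.Probability.LatticeModels.prodBernoulli w).real ((⋃ a ∈ A, Literature.Probability.Percolation.openConn o a) ∩ (Literature.Probability.Percolation.openConn o b)ᶜ) ≤ ∑ a ∈ A, ((((w s(o, a) : unitInterval) : ℝ)) * ∏ a' ∈ A.filter (fun a' => (Literature.Probability.LatticeModels.prodBernoulli w).real (Literature.Probability.Percolation.openConnIn (({o} : Set (Fin n))ᶜ) a b)ᶜ < (Literature.Probability.LatticeModels.prodBernoulli w).real (Literature.Probability.Percolation.openConnIn (({o} : Set (Fin n))ᶜ) a' b)ᶜ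 ∨ ((Literature.Probability.LatticeModels.prodBernoulli w).real (Literature.Probability.Percolation.openConnIn (({o} : Set (Fin n))ᶜ) a b)ᶜ = (Literature.Probability.LatticeModels.prodBernoulli w).real (Literature.Probability.Percolation.openConnIn (({o} : Set (Fin n))ᶜ) a' b)ᶜ ∧ a < a')), (1 - ((w s(o, a') : unitInterval) : ℝ))) * (Literature.Probability.LatticeModels.prodBernoulli w).real (Literature.Probability.Percolation.openConn a b)ᶜ := by
  intro n w A o b hbA hoA hw0
  -- the pieces of the law of the configuration off `o`
  obtain ⟨Ho, hHo⟩ : ∃ Ho : Finset (Sym2 (Fin n)), Ho = (Finset.univ : Finset (Sym2 (Fin n))) \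
      (Finset.univ : Finset (Sym2 (Fin n))).filter (fun e => o ∈ e) := ⟨_, rfl⟩
  obtain ⟨p, hp⟩ : ∃ p : Finset (Sym2 (Fin n)) → ℝ, ∀ η, p η =
      (Literature.Probability.LatticeModels.prodBernoulli w).real
        (Literature.Probability.Percolation.localCylinder (↑Ho : Set (Sym2 (Fin n)))
          (↑η : Set (Sym2 (Fin n)))) := ⟨_, fun _ => rfl⟩
  obtain ⟨L, hL⟩ : ∃ L : Finset (Sym2 (Fin n)) → Finset (Fin n), ∀ η, L η =
      A.filter (fun a' => (↑η : Set (Sym2 (Fin n))) ∈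
        Literature.Probability.Percolation.openConnIn (({o} : Set (Fin n))ᶜ) a' b) :=
    ⟨_, fun _ => rfl⟩
  obtain ⟨cl, hcl⟩ : ∃ cl : Finset (Sym2 (Fin n)) → Fin n → Finset (Fin n), ∀ η x, cl η x =
      A.filter (fun a' => (↑η : Set (Sym2 (Fin n))) ∈
        Literature.Probability.Percolation.openConnIn (({o} : Set (Fin n))ᶜ) x a') :=
    ⟨_, fun _ _ => rfl⟩
  -- the priority: rank by deadness, ties broken by the index
  obtain ⟨rank, hrank_inj, hrank⟩ := starFH_rank A
    (fun a => toLex ((Literature.Probability.LatticeModels.prodBernoulli w).real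
      (Literature.Probability.Percolation.openConnIn (({o} : Set (Fin n))ᶜ) a b)ᶜ, a))
    (by
      intro a _ a' _ h
      exact congrArg Prod.snd (toLex.injective h))
  have hbeats : ∀ a ∈ A, ∀ a' ∈ A, (rank a < rank a' ↔
      ((Literature.Probability.LatticeModels.prodBernoulli w).real
          (Literature.Probability.Percolation.openConnIn (({o} : Set (Fin n))ᶜ) a b)ᶜ <
        (Literature.Probability.LatticeModels.prodBernoulli w).real
          (Literature.Probability.Percolation.openConnIn (({o} : Set (Fin n))ᶜ) a' b)ᶜ ∨
      ((Literature.Probability.LatticeModels.prodBernoulli w).real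
          (Literature.Probability.Percolation.openConnIn (({o} : Set (Fin n))ᶜ) a b)ᶜ =
        (Literature.Probability.LatticeModels.prodBernoulli w).real
          (Literature.Probability.Percolation.openConnIn (({o} : Set (Fin n))ᶜ) a' b)ᶜ ∧
            a < a'))) :=
    fun a ha a' ha' => (hrank a ha a' ha').trans Prod.Lex.toLex_lt_toLex
  have hrank_d : ∀ z ∈ A, ∀ m ∈ A, rank z < rank m →
      (Literature.Probability.LatticeModels.prodBernoulli w).real
          (Literature.Probability.Percolation.openConnIn (({o} : Set (Fin n))ᶜ) z b)ᶜ ≤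
        (Literature.Probability.LatticeModels.prodBernoulli w).real
          (Literature.Probability.Percolation.openConnIn (({o} : Set (Fin n))ᶜ) m b)ᶜ := by
    intro z hz m hm h
    rcases (hbeats z hz m hm).1 h with h' | ⟨h', _⟩
    · exact h'.le
    · exact h'.le
  -- the law-level Block Star Lemma
  obtain ⟨hself, hdisj, hblk⟩ := starFH_blocks A o b hoA L cl hL hcl Ho.powerset
  have key := starLemmaBlocks_finset Ho.powerset p
    (fun η _ => by rw [hp]; exact measureReal_nonneg) A rank hrank_inj L cl hself hdisj hblk
    (fun a => ((w s(o, a) : unitInterval) : ℝ)) (fun a => unitInterval.nonneg _)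
    (fun a => unitInterval.le_one _)
    (starFH_blockExchange w A o b hoA hbA Ho hHo p hp L hL cl hcl rank hrank_d)
  beta_reduce at key
  -- identification of the two sides
  rw [starFH_badLaw w A o b hoA hbA hw0 Ho hHo p hp L hL]
  refine key.trans_eq (Finset.sum_congr rfl (fun a ha => ?_))
  rw [starFH_unrelLaw w A o b a hoA hbA ha hw0 Ho hHo p hp L hL cl hcl,
    Finset.filter_congr (hbeats a ha)]

end Summit.CriticalPhenomena.PercolationContinuityZ3.Theorems
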